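import Summits.NavierStokesRegularity.NavierStokesRegularity.Theorems.GaldiLiouvilleGateRecordZoomAncientStubZoomNondegenerate
import HarnessLib

/-!
# Route `GaldiLiouvilleGate`, crux `RecordZoomAncient` (stmt-NavierStokesRegularity-0894),
  line `registered` (birth skeleton, reshape r8) — stub `stub_oscNondegenerate`
  (an oscillation of the velocity persists backwards for a universal number of viscous times)

**Statement.** For every `θ > 0` there is a universal `s₁ ∈ [−1, 0)` such that: for a classical
solution `(u, p)` of the unforced Navier–Stokes system (viscosity `ν`) on `ℝ³ × [0, T)`,
Leray–Hopf from `u 0`, a time `tc ∈ (0, T)` with `tc ≥ 3ν/M²`, a level `M > 0` dominating `‖u‖`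
on `[0, tc] × ℝ³`, and two points with `‖u(tc, x₁) − u(tc, x₂)‖ ≥ θ M`, the oscillation
persists: `‖u(tc + ν s₁/M², x₁) − u(tc + ν s₁/M², x₂)‖ ≥ θ M/2`.

**Proof.** This is the two-point version of the sibling stub `stub_zoomNondegenerate` (KNSS 2009,
the uniform `1/4`-Hölder modulus of bounded Oseen-mild fields). First a backward modulus in
viscous units, uniform in the centre (`exists_backward_modulus_of_velocity_dominated`): there is
a universal `K > 0` with `‖u(tc + ν s/M², x) − u(tc, x)‖ ≤ K M |s|^{1/4}` for every point `x` and
every `s ∈ [−1, 0]`. Indeed, let `K₀` be the constant of `exists_holder_quarter_of_oseenMild` and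
`K = 2K₀`; the velocity-normalised zoom centred at `x`,
`z(s, y) = M⁻¹ u(tc + ν s/M², x + ν y/M) = α • stPull β γ tc x u` (`α = M⁻¹`, `γ = ν/M`,
`β = α γ = ν/M²`), is (`IsClassicalNSSolutionOn.stRescale`) a classical solution with viscosity
`α ν/γ = 1` on the window `(A, b)`, `A = −tc M²/ν ≤ −3`, `b = (T − tc) M²/ν > 0`; on `(A, 0]` it
is bounded by `1` and has `L²`-bounded slices (Leray–Hopf energy bound and the change of
variables `eLpNorm_comp_space_affine`), so it is Oseen-mild there
(`mild_of_bounded_of_eLpNorm_two_le_of_lt`). The modulus on `[−2, b']`, `b' ∈ [s, 0)`, gives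
`‖z(b', 0) − z(s, 0)‖ ≤ 2K₀ |b' − s|^{1/4} ≤ 2K₀ |s|^{1/4}`; letting `b' → 0⁻` (continuity of the
time line of the classical solution `z` at `0 ∈ (A, b)`) yields
`‖z(0, 0) − z(s, 0)‖ ≤ 2K₀ |s|^{1/4}`, i.e. `‖u(tc + ν s/M², x) − u(tc, x)‖ ≤ 2K₀ M |s|^{1/4}`.
Then, with `s₁ = −min 1 (θ/(4K))⁴` (so that `K |s₁|^{1/4} ≤ θ/4`) and `t₁ = tc + ν s₁/M²`, the
triangle inequality gives `‖u(t₁, x₁) − u(t₁, x₂)‖ ≥ ‖u(tc, x₁) − u(tc, x₂)‖ −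
‖u(tc, x₁) − u(t₁, x₁)‖ − ‖u(t₁, x₂) − u(tc, x₂)‖ ≥ θ M − θ M/4 − θ M/4 = θ M/2`.

Sources: G. Koch, N. Nadirashvili, G. Seregin, V. Šverák, Acta Math. 203 (2009) =
arXiv:0709.3599, §4 Lemma 4.1, §6 Lemma 6.1 and (6.2).
-/

noncomputable section

open Set MeasureTheory Filter Topology Function Literature.Analysis.FluidPDE
open scoped ENNReal NNReal

namespace Summit.NavierStokesRegularity.NavierStokesRegularity.Theorems.RecordZoomAncient.Birth

-- the problem-side namespace `Summit.NavierStokesRegularity.NavierStokesRegularity.…` (summit =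
-- problem for this single-problem summit) duplicates `NavierStokesRegularity` by design
set_option linter.dupNamespace false

/-- **Backward `1/4`-Hölder modulus in viscous units, uniform in the centre** (KNSS 2009,
Lemma 4.1 / Lemma 6.1, rescaled): there is a universal `K > 0` such that for a classical solution
`(u, p)` on `ℝ³ × [0, T)`, Leray–Hopf from `u 0`, a time `tc ∈ (0, T)` with `tc ≥ 3ν/M²` and a
level `M > 0` dominating `‖u‖` on `[0, tc] × ℝ³`, one has
`‖u(tc + ν s/M², x) − u(tc, x)‖ ≤ K M |s|^{1/4}` for every point `x` and every `s ∈ [−1, 0]`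
(proof in the module docstring: the argument of the sibling `stub_zoomNondegenerate` with the
zoom centred at `x`). -/
theorem exists_backward_modulus_of_velocity_dominated :
    ∃ K : ℝ, 0 < K ∧ ∀ (ν T : ℝ), 0 < ν → 0 < T →
      ∀ (u : ℝ → EuclideanSpace ℝ (Fin 3) → EuclideanSpace ℝ (Fin 3)) (p : ℝ → EuclideanSpace ℝ (Fin 3) → ℝ),
        IsClassicalNSSolutionOn (Set.Ico 0 T) ν 0 u p → IsLerayHopfOn T ν 0 (u 0) u →
        ∀ (tc M : ℝ), 0 < tc → tc < T → 0 < M → 3 * (ν / M ^ 2) ≤ tc →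
          (∀ t ∈ Set.Icc 0 tc, ∀ x, ‖u t x‖ ≤ M) →
          ∀ (x : EuclideanSpace ℝ (Fin 3)), ∀ s ∈ Set.Icc (-1 : ℝ) 0,
            ‖u (tc + ν / M ^ 2 * s) x - u tc x‖ ≤ K * M * |s| ^ (1 / 4 : ℝ) := by
  -- ### the universal Hölder constant, `K = K₀ (1 + 1²)`
  obtain ⟨K₀, hK₀, hHold⟩ := exists_holder_quarter_of_oseenMild (E := EuclideanSpace ℝ (Fin 3))
  refine ⟨K₀ * (1 + 1 ^ 2), by positivity, ?_⟩
  intro ν T hν hT u p hcl hLH tc M htc htcT hM h3 hdom xc s hs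
  -- the degenerate case `s = 0`
  rcases hs.2.eq_or_lt with rfl | hs0
  · rw [mul_zero, add_zero, sub_self, norm_zero]
    positivity
  have hs1 : -1 ≤ s := hs.1
  -- ### scales `α = M⁻¹`, `γ = ν/M`, `β = α γ = ν/M²` (viscosity `α ν/γ = 1`), window `(A, b)`
  have hαpos : 0 < M⁻¹ := inv_pos.2 hM
  have hγpos : 0 < ν / M := div_pos hν hM
  have hβpos : 0 < ν / M ^ 2 := div_pos hν (pow_pos hM 2)
  obtain ⟨A, hA⟩ : ∃ A : ℝ, A = -(tc * M ^ 2 / ν) := ⟨_, rfl⟩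
  obtain ⟨b, hb⟩ : ∃ b : ℝ, b = (T - tc) * M ^ 2 / ν := ⟨_, rfl⟩
  have halg : ∀ σ, ν / M ^ 2 = M⁻¹ * (ν / M) ∧ M⁻¹ * ν / (ν / M) = 1 ∧
      tc + ν / M ^ 2 * σ = ν / M ^ 2 * (σ - A) ∧
      T - (tc + ν / M ^ 2 * σ) = ν / M ^ 2 * (b - σ) ∧ tc = ν / M ^ 2 * (-A) := by
    intro σ
    have hM0 : M ≠ 0 := hM.ne'
    have hν0 : ν ≠ 0 := hν.ne'
    rw [hA, hb]
    refine ⟨?_, ?_, ?_, ?_, ?_⟩ <;> field_simp <;> ring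
  have hA3 : A ≤ -3 := by
    obtain ⟨-, -, -, -, htcA⟩ := halg 0
    rw [htcA] at h3
    nlinarith
  have hbpos : 0 < b :=
    hb ▸ div_pos (mul_pos (sub_pos.2 htcT) (pow_pos hM 2)) hν
  -- original times of rescaled times
  have hmem_Ico : ∀ σ, A < σ → σ < b → tc + ν / M ^ 2 * σ ∈ Ico 0 T := by
    intro σ h1 h2
    obtain ⟨-, -, hoA, hob, -⟩ := halg σ
    have h3' : 0 < ν / M ^ 2 * (σ - A) := mul_pos hβpos (by linarith)
    have h4 : 0 < ν / M ^ 2 * (b - σ) := mul_pos hβpos (by linarith)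
    constructor <;> linarith
  have hmem_Icc : ∀ σ, A < σ → σ ≤ 0 → tc + ν / M ^ 2 * σ ∈ Icc 0 tc := by
    intro σ h1 h2
    obtain ⟨-, -, hoA, -, -⟩ := halg σ
    have h3' : 0 ≤ ν / M ^ 2 * (σ - A) := mul_nonneg hβpos.le (by linarith)
    have h4 : ν / M ^ 2 * σ ≤ 0 := mul_nonpos_of_nonneg_of_nonpos hβpos.le h2
    constructor <;> linarith
  -- ### the zoom centred at `xc`: viscosity `1` on `(A, b)`, bounded by `1` on `(A, 0]`
  obtain ⟨z, hz⟩ : ∃ z : ℝ → EuclideanSpace ℝ (Fin 3) → EuclideanSpace ℝ (Fin 3),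
      z = M⁻¹ • stPull (ν / M ^ 2) (ν / M) tc xc u := ⟨_, rfl⟩
  have hz_apply : ∀ σ y, z σ y = M⁻¹ • u (tc + ν / M ^ 2 * σ) (xc + (ν / M) • y) :=
    fun σ y => by rw [hz]; rfl
  have hzslice : ∀ σ, z σ = M⁻¹ • fun y => u (tc + ν / M ^ 2 * σ) (xc + (ν / M) • y) :=
    fun σ => by rw [hz]; rfl
  have hclz : IsClassicalNSSolutionOn (Ioo A b) 1 0 z
      ((M⁻¹) ^ 2 • stPull (ν / M ^ 2) (ν / M) tc xc p) := by
    obtain ⟨hβeq, hvisc, -⟩ := halg 0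
    have h := hcl.stRescale hαpos hγpos hβeq tc xc
    rw [smul_stPull_zero, hvisc, ← hz] at h
    exact h.mono (fun σ hσ => hmem_Ico σ hσ.1 hσ.2) (uniqueDiffOn_Ioo _ _)
  have hzb : ∀ σ, A < σ → σ ≤ 0 → ∀ y, ‖z σ y‖ ≤ 1 := by
    intro σ h1 h2 y
    rw [hz_apply, norm_smul, norm_inv, Real.norm_of_nonneg hM.le, inv_mul_le_iff₀ hM, mul_one]
    exact hdom _ (hmem_Icc σ h1 h2) _
  -- `L²` bounds of the zoom slices (Leray–Hopf energy bound and change of variables)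
  obtain ⟨E2, hE2top, hE2⟩ : ∃ E2 : ℝ≥0∞, E2 ≠ ∞ ∧ ∀ t ∈ Icc 0 T, eLpNorm (u t) 2 volume ≤ E2 := by
    refine ⟨ENNReal.ofReal (Real.sqrt (2 * VectorCalculus.kineticEnergy (u 0))),
      ENNReal.ofReal_ne_top, fun t ht => (ENNReal.pow_le_pow_left_iff two_ne_zero).1 ?_⟩
    rw [eLpNorm_two_sq_eq_lintegral, ← ENNReal.ofReal_pow (Real.sqrt_nonneg _),
      Real.sq_sqrt (mul_nonneg zero_le_two (kineticEnergy_nonneg _))]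
    exact hLH.lintegral_enorm_sq_le hν.le ht
  obtain ⟨K, hKtop, hK⟩ : ∃ K : ℝ≥0∞, K ≠ ∞ ∧ ∀ σ, A < σ → σ ≤ 0 → eLpNorm (z σ) 2 volume ≤ K := by
    refine ⟨‖M⁻¹‖ₑ *
      (ENNReal.ofReal ((ν / M) ^ Module.finrank ℝ (EuclideanSpace ℝ (Fin 3)))⁻¹ ^
        (1 / (2 : ℝ≥0∞)).toReal * E2), ?_, fun σ h1 h2 => ?_⟩
    · exact ENNReal.mul_ne_top enorm_ne_top (ENNReal.mul_ne_top
        (ENNReal.rpow_ne_top_of_nonneg ENNReal.toReal_nonneg ENNReal.ofReal_ne_top) hE2top)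
    · rw [hzslice σ, eLpNorm_const_smul, eLpNorm_comp_space_affine hγpos xc _ 2]
      gcongr
      exact hE2 _ ⟨(hmem_Icc σ h1 h2).1, (hmem_Icc σ h1 h2).2.trans htcT.le⟩
  -- the Oseen identity of the zoom between negative times of its bounded region
  have hmildz : ∀ σ τ : ℝ, A < σ → σ < τ → τ < 0 → ∀ x,
      z τ x = Literature.Analysis.UnboundedOperators.heatExtension (z σ) (τ - σ) x -
        oseenDuhamel 1 σ z z τ x :=
    fun σ τ h1 h2 h3' x =>
      mild_of_bounded_of_eLpNorm_two_le_of_lt hclz (h1.trans (h2.trans h3')) hbpos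
        (fun τ' hτ' y => hzb τ' hτ'.1 hτ'.2 y) hKtop (fun τ' hτ' => hK τ' hτ'.1 hτ'.2) h1 h2 h3' x
  -- ### the Hölder modulus on `[-2, b']`, `b' ∈ [s, 0)`
  have hholder : ∀ b' : ℝ, s ≤ b' → b' < 0 →
      ‖z b' 0 - z s 0‖ ≤ K₀ * (1 + 1 ^ 2) * |s| ^ (1 / 4 : ℝ) := by
    intro b' h1 h2
    have hcont : ∀ t ∈ Icc (-2 : ℝ) b', Continuous (z t) := fun t ht =>
      (hclz.contDiff_velocity ⟨by linarith [ht.1], by linarith [ht.2]⟩).continuous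
    have hbd : ∀ t ∈ Icc (-2 : ℝ) b', ∀ x, ‖z t x‖ ≤ 1 := fun t ht x =>
      hzb t (by linarith [ht.1]) (by linarith [ht.2]) x
    have hmild' : ∀ σ τ : ℝ, -2 ≤ σ → σ < τ → τ ≤ b' → ∀ x,
        z τ x = Literature.Analysis.UnboundedOperators.heatExtension (z σ) (τ - σ) x -
          oseenDuhamel 1 σ z z τ x :=
      fun σ τ hσ hστ hτ x => hmildz σ τ (by linarith) hστ (by linarith) x
    have h := hHold zero_le_one hcont hbd hmild' s ⟨by linarith, h1⟩ b' ⟨by linarith, le_rfl⟩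
      0 0
    rw [sub_self, norm_zero, max_eq_left (abs_nonneg _)] at h
    calc ‖z b' 0 - z s 0‖ ≤ K₀ * (1 + 1 ^ 2) * |b' - s| ^ (1 / 4 : ℝ) := h
      _ ≤ K₀ * (1 + 1 ^ 2) * |s| ^ (1 / 4 : ℝ) := by
          refine mul_le_mul_of_nonneg_left (Real.rpow_le_rpow (abs_nonneg _) ?_ (by norm_num))
            (by positivity)
          rw [abs_of_nonneg (sub_nonneg.2 h1), abs_of_neg hs0]
          linarith
  -- ### the limit `b' → 0⁻` (continuity of the time line of `z` at `0 ∈ (A, b)`)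
  have hcont0 : ContinuousAt (fun σ => z σ 0) 0 := by
    have h1 : ContinuousAt (uncurry z) ((0 : ℝ), (0 : EuclideanSpace ℝ (Fin 3))) :=
      hclz.smooth_velocity.continuousOn.continuousAt
        (prod_mem_nhds (Ioo_mem_nhds (by linarith) hbpos) univ_mem)
    have h2 : ContinuousAt (fun σ : ℝ => (σ, (0 : EuclideanSpace ℝ (Fin 3)))) 0 :=
      (continuous_id.prodMk continuous_const).continuousAt
    have h3 : ContinuousAt (uncurry z ∘ fun σ : ℝ => (σ, (0 : EuclideanSpace ℝ (Fin 3)))) 0 :=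
      h1.comp_of_eq h2 rfl
    exact h3
  have htend : Tendsto (fun σ => ‖z σ 0 - z s 0‖) (𝓝[<] 0) (𝓝 ‖z 0 0 - z s 0‖) :=
    ((hcont0.tendsto.sub_const _).norm).mono_left nhdsWithin_le_nhds
  have hev : ∀ᶠ σ in 𝓝[<] (0 : ℝ), ‖z σ 0 - z s 0‖ ≤ K₀ * (1 + 1 ^ 2) * |s| ^ (1 / 4 : ℝ) := by
    filter_upwards [Ico_mem_nhdsLT hs0] with σ hσ
    exact hholder σ hσ.1 hσ.2
  have hlim : ‖z 0 0 - z s 0‖ ≤ K₀ * (1 + 1 ^ 2) * |s| ^ (1 / 4 : ℝ) := le_of_tendsto htend hev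
  -- ### conclusion (undo the velocity normalisation)
  have hzdiff : ‖z 0 0 - z s 0‖ = M⁻¹ * ‖u (tc + ν / M ^ 2 * s) xc - u tc xc‖ := by
    rw [hz_apply, hz_apply, mul_zero, add_zero, smul_zero, add_zero, ← smul_sub, norm_smul,
      norm_inv, Real.norm_of_nonneg hM.le, norm_sub_rev]
  rw [hzdiff, ← div_eq_inv_mul, div_le_iff₀ hM] at hlim
  exact hlim.trans_eq (by ring)

/-- **Stub `stub_oscNondegenerate` (r8, R3): an oscillation persists backwards for a universal
number of viscous times.** For every `θ > 0` there is a universal `s₁ ∈ [−1, 0)` such that: for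
a classical solution `(u, p)` on `ℝ³ × [0, T)`, Leray–Hopf from `u 0`, a time `tc ∈ (0, T)` with
`tc ≥ 3ν/M²`, a level `M > 0` dominating `‖u‖` on `[0, tc] × ℝ³`, and two points with
`‖u(tc, x₁) − u(tc, x₂)‖ ≥ θ M`, one has `‖u(tc + ν s₁/M², x₁) − u(tc + ν s₁/M², x₂)‖ ≥ θ M/2`
(the backward modulus `exists_backward_modulus_of_velocity_dominated` at `x₁` and at `x₂`, and
the triangle inequality; proof in the module docstring). -/
theorem stub_oscNondegenerate :
    ∀ θ : ℝ, 0 < θ → ∃ s₁ : ℝ, s₁ < 0 ∧ -1 ≤ s₁ ∧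
      ∀ (ν T : ℝ), 0 < ν → 0 < T →
        ∀ (u : ℝ → EuclideanSpace ℝ (Fin 3) → EuclideanSpace ℝ (Fin 3)) (p : ℝ → EuclideanSpace ℝ (Fin 3) → ℝ),
          IsClassicalNSSolutionOn (Set.Ico 0 T) ν 0 u p → IsLerayHopfOn T ν 0 (u 0) u →
          ∀ (tc : ℝ) (x₁ x₂ : EuclideanSpace ℝ (Fin 3)) (M : ℝ), 0 < tc → tc < T → 0 < M →
            3 * (ν / M ^ 2) ≤ tc →
            (∀ t ∈ Set.Icc 0 tc, ∀ x, ‖u t x‖ ≤ M) →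
            θ * M ≤ ‖u tc x₁ - u tc x₂‖ →
            θ / 2 * M ≤ ‖u (tc + ν / M ^ 2 * s₁) x₁ - u (tc + ν / M ^ 2 * s₁) x₂‖ := by
  intro θ hθ
  -- ### the universal backward modulus `K` and the choice of `s₁ = -δ`, `K δ^{1/4} ≤ θ/4`
  obtain ⟨K, hK, hmod⟩ := exists_backward_modulus_of_velocity_dominated
  obtain ⟨c, hc⟩ : ∃ c : ℝ, c = θ / (4 * K) := ⟨_, rfl⟩
  have hcpos : 0 < c := hc ▸ div_pos hθ (by positivity)
  obtain ⟨δ, hδ⟩ : ∃ δ : ℝ, δ = min 1 (c ^ 4) := ⟨_, rfl⟩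
  have hδpos : 0 < δ := hδ ▸ lt_min one_pos (pow_pos hcpos 4)
  have hδ1 : δ ≤ 1 := hδ ▸ min_le_left _ _
  have hδc : δ ^ (1 / 4 : ℝ) ≤ c := by
    calc δ ^ (1 / 4 : ℝ) ≤ (c ^ 4) ^ (1 / 4 : ℝ) :=
          Real.rpow_le_rpow hδpos.le (hδ ▸ min_le_right _ _) (by norm_num)
      _ = c := by
          rw [show (1 / 4 : ℝ) = ((4 : ℕ) : ℝ)⁻¹ by norm_num]
          exact Real.pow_rpow_inv_natCast hcpos.le four_ne_zero
  have hKδ : K * δ ^ (1 / 4 : ℝ) ≤ θ / 4 := by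
    have h1 : K * δ ^ (1 / 4 : ℝ) ≤ K * c := mul_le_mul_of_nonneg_left hδc hK.le
    have h2 : K * c = θ / 4 := by
      rw [hc, mul_div_assoc', mul_comm K θ, mul_comm 4 K, ← div_div, mul_div_cancel_right₀ θ hK.ne']
    linarith
  refine ⟨-δ, by linarith, by linarith, ?_⟩
  intro ν T hν hT u p hcl hLH tc x₁ x₂ M htc htcT hM h3 hdom hosc
  -- ### the modulus at `x₁` and at `x₂`, and the triangle inequality
  have hsI : -δ ∈ Set.Icc (-1 : ℝ) 0 := ⟨by linarith, by linarith⟩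
  have habs : |(-δ)| = δ := by rw [abs_neg, abs_of_pos hδpos]
  have hpt : ∀ x, ‖u (tc + ν / M ^ 2 * -δ) x - u tc x‖ ≤ θ / 4 * M := by
    intro x
    calc ‖u (tc + ν / M ^ 2 * -δ) x - u tc x‖ ≤ K * M * |(-δ)| ^ (1 / 4 : ℝ) :=
          hmod ν T hν hT u p hcl hLH tc M htc htcT hM h3 hdom x (-δ) hsI
      _ = K * δ ^ (1 / 4 : ℝ) * M := by rw [habs]; ring
      _ ≤ θ / 4 * M := mul_le_mul_of_nonneg_right hKδ hM.le
  have h₁ : ‖u tc x₁ - u (tc + ν / M ^ 2 * -δ) x₁‖ ≤ θ / 4 * M := by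
    rw [norm_sub_rev]
    exact hpt x₁
  have h₂ : ‖u (tc + ν / M ^ 2 * -δ) x₂ - u tc x₂‖ ≤ θ / 4 * M := hpt x₂
  have htri : ‖u tc x₁ - u tc x₂‖ ≤ ‖u tc x₁ - u (tc + ν / M ^ 2 * -δ) x₁‖ +
      ‖u (tc + ν / M ^ 2 * -δ) x₁ - u (tc + ν / M ^ 2 * -δ) x₂‖ +
      ‖u (tc + ν / M ^ 2 * -δ) x₂ - u tc x₂‖ := by
    calc ‖u tc x₁ - u tc x₂‖
        = ‖u tc x₁ - u (tc + ν / M ^ 2 * -δ) x₁ +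
            (u (tc + ν / M ^ 2 * -δ) x₁ - u (tc + ν / M ^ 2 * -δ) x₂) +
            (u (tc + ν / M ^ 2 * -δ) x₂ - u tc x₂)‖ := by
          rw [sub_add_sub_cancel, sub_add_sub_cancel]
      _ ≤ _ := norm_add₃_le
  linarith

end Summit.NavierStokesRegularity.NavierStokesRegularity.Theorems.RecordZoomAncient.Birth

end
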